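import Mathlib

/-!
# Tightness of the Landau step of line `tauberian-omega-limit`: the LOWER pinching is necessary,
# even for convergence of the adapted frequency to SOME limit

Negative-side support for crux `AdaptedFrequencyConverges` (stmt-NavierStokesRegularity-10493, route
`AdaptedFrequency`), cdisprove seat, cycle 2 (2026-08-16).  Pure real analysis (Mathlib only).

The landed `stub_landau` (`…Theorems.AdaptedFrequencyConverges.TauberianOmegaLimit.stub_landau`)
says: `H` differentiable on `[t₁,T)`, TWO-sided pinching `c₀ ≤ (T−t)² H ≤ C₁` with `0 < c₀`, and
`Λ = (T−t)H′/H` slowly decreasing over dyadic windows `⇒ Λ → 2`.  The crux itself only asks for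
SOME limit `Λ₀`, so a prover might hope to bypass the far-field stub `stub_pinchingLower` (false
without the far-field hypotheses: `…Negative.stub_pinchingLower_false_without_decay`) by settling for
an arbitrary limit.  This file closes that door:

* `landau_false_without_lower_pinching`: there is a positive differentiable `H` on `[0,1)` with
  `(1−t)² H ≤ C₁`, whose frequency `Λ(t) = 1 + ½ sin log(1 − log(1−t))` is even SLOWLY OSCILLATING
  (`|Λ t − Λ t'| ≤ ε` on late dyadic windows, both signs) and bounded, but has NO limit at `1⁻`
  (witness `landauH t = exp(2s + f(s))`, `s = −log(1−t)`,
  `f(s) = −s + (1+s)(sin log(1+s) − cos log(1+s))/4`, `f′ = −1 + ½ sin log(1+s)`);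
* `stub_landau_false_without_lower_pinching`: hence `stub_landau` with the conjunct `c₀ ≤ (T−t)² H`
  deleted (keeping `0 < H`) is false — even with its conclusion weakened from `Λ → 2` to `∃ Λ₀, Λ → Λ₀`.

So within the Tauberian frame the lower pinching `c₀ ≤ (T−t)² H` (enstrophy concentration at the
Type-I rate, the far-field step) cannot be traded for the weaker conclusion of the crux: slow decrease
(or even slow oscillation) of `Λ` plus the Type-I upper bound leave room for a bounded, non-convergent,
slowly log-log-periodic frequency.  (The symmetric statement without the UPPER pinching is also false —
`f′ = +1 + ½ sin log(1+s)` — but the upper pinching is landed: `stub_pinchingUpper`.)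
-/

noncomputable section

open scoped Topology
open Set Filter Real

namespace Summit.NavierStokesRegularity.NavierStokesRegularity.Theorems.AdaptedFrequencyConverges.Negative

/-! ## The witness -/

/-- similarity time `s(t) = −log(1−t)` [folklore] -/
def simTime (t : ℝ) : ℝ := -Real.log (1 - t)

/-- the profile exponent `f(s) = −s + (1+s)(sin log(1+s) − cos log(1+s))/4` [folklore] -/
def prof (s : ℝ) : ℝ :=
  -s + (1 + s) * (Real.sin (Real.log (1 + s)) - Real.cos (Real.log (1 + s))) / 4

/-- `f′(s) = −1 + ½ sin log(1+s)` [folklore] -/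
def profDeriv (s : ℝ) : ℝ := -1 + Real.sin (Real.log (1 + s)) / 2

/-- the witness "enstrophy" `H(t) = exp(2 s(t) + f(s(t))) = (1−t)⁻² e^{f(s(t))}` [folklore] -/
def landauH (t : ℝ) : ℝ := Real.exp (2 * simTime t + prof (simTime t))

/-- `H > 0` [folklore] -/
theorem landauH_pos (t : ℝ) : 0 < landauH t := Real.exp_pos _

/-- `ds/dt = 1/(1−t)` [folklore] -/
theorem hasDerivAt_simTime {t : ℝ} (ht : t < 1) : HasDerivAt simTime (1 - t)⁻¹ t := by
  have h1 : HasDerivAt (fun s : ℝ => 1 - s) (-1) t := (hasDerivAt_id t).const_sub 1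
  have h2 := ((Real.hasDerivAt_log (sub_pos.2 ht).ne').comp t h1).neg
  unfold simTime
  refine h2.congr_deriv ?_
  ring

/-- `s ≥ 0` on `[0, 1)` [folklore] -/
theorem simTime_nonneg {t : ℝ} (h0 : 0 ≤ t) (h1 : t < 1) : 0 ≤ simTime t := by
  unfold simTime
  have := Real.log_nonpos (sub_nonneg.2 h1.le) (by linarith : 1 - t ≤ 1)
  linarith

/-- `f′ = profDeriv` on `s > −1` [folklore] -/
theorem hasDerivAt_prof {s : ℝ} (hs : -1 < s) : HasDerivAt prof (profDeriv s) s := by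
  have h0 : (0:ℝ) < 1 + s := by linarith
  have h1 : HasDerivAt (fun x : ℝ => 1 + x) 1 s := (hasDerivAt_id s).const_add 1
  have hL : HasDerivAt (fun x : ℝ => Real.log (1 + x)) ((1 + s)⁻¹ * 1) s :=
    (Real.hasDerivAt_log h0.ne').comp s h1
  have h2 : HasDerivAt (fun x : ℝ => (1 + x) * (Real.sin (Real.log (1 + x)) - Real.cos (Real.log (1 + x))))
      (1 * (Real.sin (Real.log (1 + s)) - Real.cos (Real.log (1 + s))) +
        (1 + s) * (Real.cos (Real.log (1 + s)) * ((1 + s)⁻¹ * 1) -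
          -Real.sin (Real.log (1 + s)) * ((1 + s)⁻¹ * 1))) s :=
    h1.mul ((hL.sin).sub (hL.cos))
  have h3 : HasDerivAt (fun x : ℝ => -x + (1 + x) * (Real.sin (Real.log (1 + x)) - Real.cos (Real.log (1 + x))) / 4)
      (-1 + (1 * (Real.sin (Real.log (1 + s)) - Real.cos (Real.log (1 + s))) +
        (1 + s) * (Real.cos (Real.log (1 + s)) * ((1 + s)⁻¹ * 1) -
          -Real.sin (Real.log (1 + s)) * ((1 + s)⁻¹ * 1))) / 4) s :=
    (hasDerivAt_id' s).neg.add (h2.div_const 4)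
  unfold prof profDeriv
  refine h3.congr_deriv ?_
  field_simp
  ring

/-- `H′ = H · (2 + f′(s)) / (1−t)` [folklore] -/
theorem hasDerivAt_landauH {t : ℝ} (ht : t < 1) (hs : -1 < simTime t) :
    HasDerivAt landauH (landauH t * ((2 + profDeriv (simTime t)) * (1 - t)⁻¹)) t := by
  have h1 := hasDerivAt_simTime ht
  have h2 : HasDerivAt (fun x => 2 * simTime x + prof (simTime x))
      (2 * (1 - t)⁻¹ + profDeriv (simTime t) * (1 - t)⁻¹) t :=
    (h1.const_mul 2).add ((hasDerivAt_prof hs).comp t h1)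
  have h3 := h2.exp
  unfold landauH
  refine h3.congr_deriv ?_
  ring

/-- **the frequency of the witness**: `(1−t) H′/H = 1 + ½ sin log(1 + s(t))` [folklore] -/
theorem landau_frequency_eq {t : ℝ} (ht : t < 1) (hs : -1 < simTime t) :
    (1 - t) * deriv landauH t / landauH t = 1 + Real.sin (Real.log (1 + simTime t)) / 2 := by
  rw [(hasDerivAt_landauH ht hs).deriv]
  have hH : landauH t ≠ 0 := (landauH_pos t).ne'
  have h1 : (1 - t) ≠ 0 := (sub_pos.2 ht).ne'
  unfold profDeriv
  field_simp
  ring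

/-- **upper pinching holds**: `(1−t)² H(t) = e^{f(s)} ≤ e^{1/2}` on `[0,1)` [folklore] -/
theorem sq_mul_landauH_le {t : ℝ} (h0 : 0 ≤ t) (h1 : t < 1) :
    (1 - t) ^ 2 * landauH t ≤ Real.exp (1 / 2) := by
  have hpos : 0 < 1 - t := sub_pos.2 h1
  have hs := simTime_nonneg h0 h1
  have heq : (1 - t) ^ 2 * landauH t = Real.exp (prof (simTime t)) := by
    have h2 : (1 - t) ^ 2 = Real.exp (2 * Real.log (1 - t)) := by
      rw [show (2 : ℝ) * Real.log (1 - t) = ((2 : ℕ) : ℝ) * Real.log (1 - t) by norm_num,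
        Real.exp_nat_mul, Real.exp_log hpos]
    rw [h2, landauH, ← Real.exp_add]
    congr 1
    unfold simTime
    ring
  rw [heq, Real.exp_le_exp]
  unfold prof
  set L := Real.log (1 + simTime t)
  have h3 : (1 + simTime t) * (Real.sin L - Real.cos L) ≤ (1 + simTime t) * 2 :=
    mul_le_mul_of_nonneg_left (by linarith [Real.sin_le_one L, Real.neg_one_le_cos L]) (by linarith)
  linarith

/-- **slow oscillation** of the frequency of the witness over dyadic windows (both signs; in
particular it is slowly decreasing in the sense of the line). [folklore] -/
theorem landau_frequency_slowlyOscillating {ε : ℝ} (hε : 0 < ε) :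
    ∃ t₂ : ℝ, t₂ < 1 ∧ 0 ≤ t₂ ∧ ∀ t t' : ℝ, t₂ ≤ t → t ≤ t' → t' < 1 → 1 - t ≤ 2 * (1 - t') →
      |(1 - t) * deriv landauH t / landauH t - (1 - t') * deriv landauH t' / landauH t'| ≤ ε := by
  have hε2 : 0 < (2 * ε)⁻¹ := inv_pos.2 (mul_pos two_pos hε)
  refine ⟨1 - Real.exp (-(2 * ε)⁻¹), by linarith [Real.exp_pos (-(2 * ε)⁻¹)], ?_,
    fun t t' h2t htt' ht' hw => ?_⟩
  · have : Real.exp (-(2 * ε)⁻¹) ≤ 1 := Real.exp_le_one_iff.2 (by linarith)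
    linarith
  · have ht : t < 1 := htt'.trans_lt ht'
    have hpos : 0 < 1 - t := sub_pos.2 ht
    have hpos' : 0 < 1 - t' := sub_pos.2 ht'
    have hs0 : (2 * ε)⁻¹ ≤ simTime t := by
      have h1 : 1 - t ≤ Real.exp (-(2 * ε)⁻¹) := by linarith
      have h2 : Real.log (1 - t) ≤ -(2 * ε)⁻¹ := by
        have := Real.log_le_log hpos h1
        rwa [Real.log_exp] at this
      unfold simTime
      linarith
    have hss' : simTime t ≤ simTime t' := by
      unfold simTime
      have := Real.log_le_log hpos' (by linarith : 1 - t' ≤ 1 - t)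
      linarith
    have hs'le : simTime t' ≤ simTime t + 1 := by
      unfold simTime
      have hq : 0 < (1 - t) / (1 - t') := div_pos hpos hpos'
      have h1 : Real.log ((1 - t) / (1 - t')) ≤ (1 - t) / (1 - t') - 1 := Real.log_le_sub_one_of_pos hq
      have h2 : (1 - t) / (1 - t') ≤ 2 := by rw [div_le_iff₀ hpos']; linarith
      have h3 : Real.log ((1 - t) / (1 - t')) = Real.log (1 - t) - Real.log (1 - t') :=
        Real.log_div hpos.ne' hpos'.ne'
      linarith
    have hspos : 0 < 1 + simTime t := by linarith
    have hspos' : 0 < 1 + simTime t' := by linarith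
    rw [landau_frequency_eq ht (by linarith), landau_frequency_eq ht' (by linarith)]
    have hL : |Real.log (1 + simTime t) - Real.log (1 + simTime t')| ≤ (1 + simTime t)⁻¹ := by
      have hle : Real.log (1 + simTime t) ≤ Real.log (1 + simTime t') :=
        Real.log_le_log hspos (by linarith)
      rw [abs_sub_comm, abs_of_nonneg (by linarith)]
      have hq : 0 < (1 + simTime t') / (1 + simTime t) := div_pos hspos' hspos
      have h1 := Real.log_le_sub_one_of_pos hq
      rw [Real.log_div hspos'.ne' hspos.ne'] at h1
      have h2 : (1 + simTime t') / (1 + simTime t) - 1 = (simTime t' - simTime t) / (1 + simTime t) := by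
        field_simp
        ring
      have h3 : (simTime t' - simTime t) / (1 + simTime t) ≤ 1 / (1 + simTime t) :=
        div_le_div_of_nonneg_right (by linarith) hspos.le
      rw [one_div] at h3
      linarith
    have hsin := Real.abs_sin_sub_sin_le (Real.log (1 + simTime t)) (Real.log (1 + simTime t'))
    have hinv : (1 + simTime t)⁻¹ ≤ 2 * ε := by
      rw [inv_le_comm₀ hspos (mul_pos two_pos hε)]
      linarith
    have heq : |1 + Real.sin (Real.log (1 + simTime t)) / 2 -
          (1 + Real.sin (Real.log (1 + simTime t')) / 2)| =
        |Real.sin (Real.log (1 + simTime t)) - Real.sin (Real.log (1 + simTime t'))| / 2 := by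
      rw [show 1 + Real.sin (Real.log (1 + simTime t)) / 2 -
          (1 + Real.sin (Real.log (1 + simTime t')) / 2) =
          (Real.sin (Real.log (1 + simTime t)) - Real.sin (Real.log (1 + simTime t'))) / 2 by ring,
        abs_div, abs_two]
    rw [heq]
    linarith

/-- **the frequency of the witness has no limit at `1⁻`**: it equals `3/2` along
`1 − e·exp(−e^{π/2+2πn})` and `1/2` along `1 − e·exp(−e^{−π/2+2πn})`. [folklore] -/
theorem landau_frequency_not_tendsto :
    ¬ ∃ Λ₀ : ℝ, Tendsto (fun t => (1 - t) * deriv landauH t / landauH t) (𝓝[<] 1) (𝓝 Λ₀) := by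
  rintro ⟨Λ₀, hlim⟩
  set seq : ℝ → ℕ → ℝ := fun c n => 1 - Real.exp 1 * Real.exp (-Real.exp (c + n * (2 * π)))
    with hseq_def
  have hlt : ∀ c n, seq c n < 1 := fun c n => by
    simp only [hseq_def]
    nlinarith [Real.exp_pos 1, Real.exp_pos (-Real.exp (c + n * (2 * π)))]
  have hseq : ∀ c, Tendsto (seq c) atTop (𝓝[<] (1:ℝ)) := by
    intro c
    refine tendsto_nhdsWithin_iff.2 ⟨?_, Eventually.of_forall fun n => hlt c n⟩
    have h1 : Tendsto (fun n : ℕ => c + (n : ℝ) * (2 * π)) atTop atTop :=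
      tendsto_atTop_add_const_left _ _ (tendsto_natCast_atTop_atTop.atTop_mul_const (by positivity))
    have h2 : Tendsto (fun n : ℕ => Real.exp (c + n * (2 * π))) atTop atTop :=
      Real.tendsto_exp_atTop.comp h1
    have h3 := Real.tendsto_exp_neg_atTop_nhds_zero.comp h2
    have h4 := (h3.const_mul (Real.exp 1)).const_sub 1
    simp only [mul_zero, sub_zero] at h4
    exact h4
  have hval : ∀ c n, (1 - seq c n) * deriv landauH (seq c n) / landauH (seq c n) = 1 + Real.sin c / 2 := by
    intro c n
    have h1t : 1 - seq c n = Real.exp 1 * Real.exp (-Real.exp (c + n * (2 * π))) := by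
      simp only [hseq_def]; ring
    have hsim : simTime (seq c n) = Real.exp (c + n * (2 * π)) - 1 := by
      unfold simTime
      rw [h1t, Real.log_mul (Real.exp_pos 1).ne' (Real.exp_pos _).ne', Real.log_exp, Real.log_exp]
      ring
    have hs1 : 1 + simTime (seq c n) = Real.exp (c + n * (2 * π)) := by rw [hsim]; ring
    rw [landau_frequency_eq (hlt c n) (by rw [hsim]; linarith [Real.exp_pos (c + n * (2 * π))]), hs1,
      Real.log_exp, Real.sin_add_nat_mul_two_pi]
  have hlim1 := hlim.comp (hseq (π / 2))
  have hlim2 := hlim.comp (hseq (-(π / 2)))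
  have e1 : ((fun t => (1 - t) * deriv landauH t / landauH t) ∘ seq (π / 2)) = fun _ => 3 / 2 := by
    funext n
    rw [Function.comp_apply, hval, Real.sin_pi_div_two]
    norm_num
  have e2 : ((fun t => (1 - t) * deriv landauH t / landauH t) ∘ seq (-(π / 2))) = fun _ => 1 / 2 := by
    funext n
    rw [Function.comp_apply, hval, Real.sin_neg, Real.sin_pi_div_two]
    norm_num
  rw [e1] at hlim1
  rw [e2] at hlim2
  have ha := tendsto_nhds_unique hlim1 tendsto_const_nhds
  have hb := tendsto_nhds_unique hlim2 tendsto_const_nhds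
  linarith

/-! ## The tightness statements -/

/-- **The lower pinching is necessary in the Landau step, even for convergence to SOME limit.**
Refuted: "`H` differentiable and positive on `[t₁,T)`, `(T−t)² H ≤ C₁`, and `Λ = (T−t)H′/H` slowly
OSCILLATING over dyadic windows (`|Λ t − Λ t'| ≤ ε`, both signs) `⇒ Λ` has a limit at `T⁻`".
Witness `T = 1`, `t₁ = 0`, `H = landauH`, `Λ = 1 + ½ sin log(1 − log(1−t))`. [folklore] -/
theorem landau_false_without_lower_pinching :
    ¬ (∀ (T t₁ : ℝ) (H : ℝ → ℝ), t₁ < T → (∀ t ∈ Ico t₁ T, DifferentiableAt ℝ H t) →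
        (∀ t ∈ Ico t₁ T, 0 < H t) → (∃ C₁ : ℝ, ∀ t ∈ Ico t₁ T, (T - t) ^ 2 * H t ≤ C₁) →
        (∀ ε : ℝ, 0 < ε → ∃ t₂ : ℝ, t₂ < T ∧ ∀ t t' : ℝ, t₂ ≤ t → t ≤ t' → t' < T →
          T - t ≤ 2 * (T - t') →
          |(T - t) * deriv H t / H t - (T - t') * deriv H t' / H t'| ≤ ε) →
        ∃ Λ₀ : ℝ, Tendsto (fun t => (T - t) * deriv H t / H t) (𝓝[<] T) (𝓝 Λ₀)) := by
  intro h
  refine landau_frequency_not_tendsto (h 1 0 landauH one_pos ?_ (fun t _ => landauH_pos t)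
    ⟨Real.exp (1 / 2), fun t ht => sq_mul_landauH_le ht.1 ht.2⟩ ?_)
  · intro t ht
    exact (hasDerivAt_landauH ht.2 (by linarith [simTime_nonneg ht.1 ht.2])).differentiableAt
  · intro ε hε
    obtain ⟨t₂, ht₂, -, hosc⟩ := landau_frequency_slowlyOscillating hε
    exact ⟨t₂, ht₂, hosc⟩

/-- **`stub_landau` without its lower pinching is false**, even with the weaker conclusion
`∃ Λ₀, Λ → Λ₀` in place of `Λ → 2`: the statement below is the landed `stub_landau`
(`…TauberianOmegaLimit.stub_landau`) with the conjunct `c₀ ≤ (T - t) ^ 2 * H t` (and `0 < c₀`)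
replaced by `0 < H t`, and the conclusion weakened.  So the far-field stub `stub_pinchingLower`
cannot be bypassed inside the Tauberian frame. [folklore] -/
theorem stub_landau_false_without_lower_pinching :
    ¬ (∀ (T t₁ : ℝ) (H : ℝ → ℝ), t₁ < T → (∀ t ∈ Ico t₁ T, DifferentiableAt ℝ H t) →
        (∃ C₁ : ℝ, ∀ t ∈ Ico t₁ T, 0 < H t ∧ (T - t) ^ 2 * H t ≤ C₁) →
        (∀ ε : ℝ, 0 < ε → ∃ t₂ : ℝ, t₂ < T ∧ ∀ t t' : ℝ, t₂ ≤ t → t ≤ t' → t' < T →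
          T - t ≤ 2 * (T - t') → (T - t) * deriv H t / H t ≤ (T - t') * deriv H t' / H t' + ε) →
        ∃ Λ₀ : ℝ, Tendsto (fun t => (T - t) * deriv H t / H t) (𝓝[<] T) (𝓝 Λ₀)) := by
  intro h
  refine landau_false_without_lower_pinching fun T t₁ H ht₁ hd hpos hup hosc => ?_
  obtain ⟨C₁, hC₁⟩ := hup
  refine h T t₁ H ht₁ hd ⟨C₁, fun t ht => ⟨hpos t ht, hC₁ t ht⟩⟩ fun ε hε => ?_
  obtain ⟨t₂, ht₂, hw⟩ := hosc ε hε
  refine ⟨t₂, ht₂, fun t t' h1 h2 h3 h4 => ?_⟩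
  have := (abs_sub_le_iff.1 (hw t t' h1 h2 h3 h4)).1
  linarith

end Summit.NavierStokesRegularity.NavierStokesRegularity.Theorems.AdaptedFrequencyConverges.Negative

end
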